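import Literature.NumberTheory.GaloisRepresentations.QuarticTwistHeckeCharacterRamificationTwo
import HarnessLib

/-!
# The Hecke character of `y² = x³ − Dx` is RAMIFIED at every prime of `ℚ(i)` dividing `2D`
# (the conductor half of Ireland–Rosen Ch. 18 §6 Theorem 7 / Deuring: `N_E = N(𝔣_ψ)·|d_K|`)

Topic `NumberTheory/GaloisRepresentations`; namespace `Literature.NumberTheory.GaloisRepresentations.QuarticTwistDatum`.
Theorems only. Sequel of `QuarticTwistHeckeCharacterRamificationTwo` (bookkeeping, `ψ̃₀((a))`, the prime over `2`): for `D ≠ 0` free of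
fourth powers and `ψ = heckeOfGross` of the datum `ψ₀(𝔭) = e((D/ϖ_𝔭)₄³)·e(ϖ_𝔭) mod (8D)`:

* §4 `natCast_notMem_sq` (an odd `p` is unramified in `ℚ(i)`), `count_normalizedFactors_span_eq` (`ord_w((±p^m c)) = m`),
  ★ `not_isUnramifiedAt_gen_odd` — at `w ∣ p`, `p` odd, `p^m ∥ D` (`1 ≤ m ≤ 3`): witness `a ≡ g (w)`, `a ≡ 1` modulo
  `∏_{v ∣ 8D, v ≠ w} 𝔭_v^{n_v+8}`, `g` a non-square mod `w`; then `ψ̃₀((a)) = e((D/(a))₄³ a)` with `(D/(a))₄ = (g/w)₄^m ≠ 1` by Prop. 9.9.8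
  (`(D″/(a))₄ = (a/(D″))₄`, `D = ±2^j D″`, `D″ ≡ 1 (4)`) and the supplements `(−1/(a))₄ = (2/(a))₄ = 1` for `a ≡ 1 (16)`, `(g/w)₄² = −1`;
* §5 ★★ `not_isUnramifiedAt_gen` — `ψ` is ramified at every `w ∣ (8D)`.

## References
* K. Ireland, M. Rosen, *A Classical Introduction to Modern Number Theory*, 2nd ed. (1990), Ch. 18 §6 Theorem 7, §7; Ch. 9 §9 Prop. 9.9.8,
  §7 Lemmas 4–5. [IrelandRosen1990]
* J. H. Silverman, *Advanced Topics in the Arithmetic of Elliptic Curves* (1994), II Thm. 10.5. [SilvermanATAEC1994]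
* J. Neukirch, *Algebraic Number Theory* (1999), Ch. VII §6 (6.14). [NeukirchANT1999]

## Mathlib / tree search
Tree: `not_isUnramifiedAt_heckeOfGross_of_ne`, `exists_complement`, `exists_place_two`, `eq_of_two_mem`, `idealPow_gen_span`, `prod_embedding_eq`,
`exists_prime_mem`, `not_isUnramifiedAt_gen_two` (`QuarticTwistHeckeCharacterRamificationTwo`); `quarticSymbol_*`, `quarticSymbol_span_intCast_primary_comm`,
`quarticResidueSymbol_sq_eq_quadraticChar`, `exists_prime_eq_mul_galRestrict_of_mod_four_eq_one`, `charP_quotient_of_natCast_mem`.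
Mathlib: `FiniteField.exists_nonsquare`, `Ideal.mem_normalizedFactors_iff`, `Ideal.count_normalizedFactors_eq`, `Multiset.prod_map_eq_pow_single`,
`Nat.exists_eq_two_pow_mul_odd`, `Nat.exists_eq_pow_mul_and_not_dvd`.
-/

noncomputable section

namespace Literature.NumberTheory.GaloisRepresentations.QuarticTwistDatum

open Finset NumberField IsDedekindDomain Literature.NumberTheory.NumberFields UniqueFactorizationMonoid
open scoped ComplexConjugate

variable {K : Type} [Field K] [NumberField K] [IsCyclotomicExtension {4} ℚ K] [IsPrincipalIdealRing (𝓞 K)]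
variable {ζ : 𝓞 K} (hζ : IsPrimitiveRoot ζ 4)

/-! ### §4 The odd primes dividing `D` -/

omit [IsPrincipalIdealRing (𝓞 K)] in
/-- **An odd rational prime is unramified in `ℚ(i)`**: `p ∉ 𝔭²` for a place `𝔭 ∋ p`, `p` odd.
[cite: IrelandRosen1990, Ch. 9 §7 Lemmas 4–5] -/
theorem natCast_notMem_sq {p : ℕ} (hp : p.Prime) (hp2 : p ≠ 2) {w : HeightOneSpectrum (𝓞 K)}
    (hpw : (p : 𝓞 K) ∈ w.asIdeal) : (p : 𝓞 K) ∉ w.asIdeal ^ 2 := by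
  obtain ⟨c, hc⟩ := exists_algEquiv_ne_one_four (K := K)
  have hodd : p % 4 = 1 ∨ p % 4 = 3 := by
    rcases hp.eq_two_or_odd with h | h
    · exact absurd h hp2
    · omega
  rcases hodd with hp1 | hp3
  · -- split: `p = π σ̂π`, `(π) ≠ (σ̂π)`
    obtain ⟨π, hπ, hpπ, hne⟩ := exists_prime_eq_mul_galRestrict_of_mod_four_eq_one (K := K) hc hp hp1
    set τ := galRestrict ℤ ℚ K (𝓞 K) c with hτ
    have hττ : ∀ x : 𝓞 K, τ (τ x) = x := fun x => by
      apply FaithfulSMul.algebraMap_injective (𝓞 K) K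
      rw [hτ, algebraMap_galRestrict_apply, algebraMap_galRestrict_apply]
      exact algEquiv_algEquiv_apply_four c _
    have hτπ : Prime (τ π) := (MulEquiv.prime_iff (τ : 𝓞 K ≃+* 𝓞 K)).mpr hπ
    have hmax : ∀ {x : 𝓞 K}, Prime x → (Ideal.span {x}).IsMaximal := fun hx =>
      ((Ideal.span_singleton_prime hx.ne_zero).mpr hx).isMaximal (by rw [Ne, Ideal.span_singleton_eq_bot]; exact hx.ne_zero)
    -- the general step: if `w = (α)` with `p = α β`, `(α) ≠ (β)`, `β` prime, then `p ∉ (α)²`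
    have key : ∀ {α β : 𝓞 K}, Prime α → Prime β → (p : 𝓞 K) = α * β → Ideal.span {α} ≠ Ideal.span {β} →
        w.asIdeal = Ideal.span {α} → (p : 𝓞 K) ∉ w.asIdeal ^ 2 := by
      intro α β hα hβ hpab hneab hwa hmem
      rw [hwa, Ideal.span_singleton_pow, Ideal.mem_span_singleton, hpab, sq] at hmem
      have hdvd : α ∣ β := (mul_dvd_mul_iff_left hα.ne_zero).mp hmem
      apply hneab
      exact ((hmax hβ).eq_of_le (hmax hα).ne_top (Ideal.span_singleton_le_span_singleton.mpr hdvd)).symm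
    rw [hpπ] at hpw
    rcases w.isPrime.mem_or_mem hpw with h | h
    · have hwa : w.asIdeal = Ideal.span {π} :=
        ((hmax hπ).eq_of_le w.isPrime.ne_top ((Ideal.span_singleton_le_iff_mem _).mpr h)).symm
      exact key hπ hτπ hpπ hne hwa
    · have hwa : w.asIdeal = Ideal.span {τ π} :=
        ((hmax hτπ).eq_of_le w.isPrime.ne_top ((Ideal.span_singleton_le_iff_mem _).mpr h)).symm
      exact key hτπ hπ (by rw [hpπ, mul_comm]) hne.symm hwa
  · -- inert: `w = (p)`
    have hw : w.asIdeal = Ideal.span {(p : 𝓞 K)} := eq_span_natCast_of_mem_of_mod_four_eq_three hp hp3 w.isPrime hpw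
    have hprime : Prime (p : 𝓞 K) := prime_natCast_of_mod_four_eq_three hp hp3
    rw [hw, Ideal.span_singleton_pow, Ideal.mem_span_singleton, sq]
    intro h
    have : (p : 𝓞 K) * p ∣ (p : 𝓞 K) * 1 := by rwa [mul_one]
    exact hprime.not_unit (isUnit_of_dvd_one ((mul_dvd_mul_iff_left hprime.ne_zero).mp this))

omit [IsPrincipalIdealRing (𝓞 K)] in
/-- **`ord_w((D″)) = m` for `D″ = ±p^m c`, `p ∤ c`, `w ∣ p` odd** (`p` unramified in `ℚ(i)`).
[cite: IrelandRosen1990, Ch. 9 §7 Lemmas 4–5] -/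
theorem count_normalizedFactors_span_eq {p : ℕ} (hp : p.Prime) (hp2 : p ≠ 2) {w : HeightOneSpectrum (𝓞 K)}
    (hpw : (p : 𝓞 K) ∈ w.asIdeal) {c : ℕ} (hc : ¬ p ∣ c) (m : ℕ) (u : ℤˣ) :
    (normalizedFactors (Ideal.span {(((u : ℤ) * (p : ℤ) ^ m * c : ℤ) : 𝓞 K)})).count w.asIdeal = m := by
  classical
  have hc0 : c ≠ 0 := by rintro rfl; exact hc (dvd_zero p)
  have hp0 : (Ideal.span {(p : 𝓞 K)}) ≠ ⊥ := by
    rw [Ne, Ideal.span_singleton_eq_bot]; exact_mod_cast hp.ne_zero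
  have hc0' : (Ideal.span {(c : 𝓞 K)}) ≠ ⊥ := by
    rw [Ne, Ideal.span_singleton_eq_bot]; exact_mod_cast hc0
  have hu : IsUnit (((u : ℤ)) : 𝓞 K) := by
    rcases Int.units_eq_one_or u with rfl | rfl
    · simp
    · push_cast; exact isUnit_one.neg
  have hspan : Ideal.span {(((u : ℤ) * (p : ℤ) ^ m * c : ℤ) : 𝓞 K)} = Ideal.span {(p : 𝓞 K)} ^ m * Ideal.span {(c : 𝓞 K)} := by
    rw [Ideal.span_singleton_pow, Ideal.span_singleton_mul_span_singleton]
    push_cast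
    rw [mul_assoc, Ideal.span_singleton_mul_left_unit hu]
  rw [hspan, normalizedFactors_mul (pow_ne_zero _ hp0) hc0', normalizedFactors_pow, Multiset.count_add,
    Multiset.count_nsmul]
  have h1 : (normalizedFactors (Ideal.span {(p : 𝓞 K)})).count w.asIdeal = 1 := by
    haveI := w.isPrime
    refine Ideal.count_normalizedFactors_eq (by rw [pow_one, Ideal.span_singleton_le_iff_mem]; exact hpw) ?_
    rw [Ideal.span_singleton_le_iff_mem]
    exact natCast_notMem_sq hp hp2 hpw
  have h0 : (normalizedFactors (Ideal.span {(c : 𝓞 K)})).count w.asIdeal = 0 := by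
    rw [Multiset.count_eq_zero, Ideal.mem_normalizedFactors_iff hc0', Ideal.span_singleton_le_iff_mem]
    rintro ⟨-, hcw⟩
    exact intCast_notMem hp (n := c) (by exact_mod_cast hc) hpw (by exact_mod_cast hcw)
  rw [h1, h0, mul_one, add_zero]

include hζ in
/-- ★ **`ψ` is ramified at every place `w ∣ p`, `p` an odd prime dividing `D`** (`D` free of fourth powers, `p^m ∥ D`, `1 ≤ m ≤ 3`).
Witness `a ≡ g (mod w)`, `a ≡ 1` modulo `∏_{v ∣ 8D, v ≠ w} 𝔭_v^{n_v+8}` (so `a ≡ 1 (16)`, primary, and `≡ 1` modulo every other prime of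
`8D`), `g` a non-square mod `w`: `ψ̃₀((a)) = e((D/(a))₄³ a)` with `(D/(a))₄ = (±1/(a))₄ (2/(a))₄^j (D″/(a))₄ = (a/(D″))₄ = (g/w)₄^m`
(`D = ±2^j D″`, `D″ ≡ 1 (4)`; Prop. 9.9.8 and the supplements), and `(g/w)₄² = −1`, so `(D/(a))₄ ≠ 1`.
[cite: IrelandRosen1990, Ch. 18 §7 (conductor of χ); Ch. 9 §9 Prop. 9.9.8] [cite: SilvermanATAEC1994, Ch. II Thm. 10.5] -/
theorem not_isUnramifiedAt_gen_odd (e : K →+* ℂ) {D : ℤ} (hD : D ≠ 0) (hD4 : ∀ q : ℕ, q.Prime → ¬ (q : ℤ) ^ 4 ∣ D)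
    {p : ℕ} (hp : p.Prime) (hp2 : p ≠ 2) {w : HeightOneSpectrum (𝓞 K)} (hpw : (p : 𝓞 K) ∈ w.asIdeal)
    (h𝔣w : Ideal.span {((8 * D : ℤ) : 𝓞 K)} ≤ w.asIdeal) :
    ¬ (heckeOfGross (span_ne_bot hD) (isGrossencharakter_gen hζ e hD)).IsUnramifiedAt w := by
  classical
  haveI : IsTotallyComplex K := IsCyclotomicExtension.Rat.isTotallyComplex K (by norm_num : 2 < 4)
  haveI := Fact.mk hp
  set 𝔣 : Ideal (𝓞 K) := Ideal.span {((8 * D : ℤ) : 𝓞 K)} with h𝔣def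
  have h𝔣 : 𝔣 ≠ ⊥ := span_ne_bot hD
  have hψ := isGrossencharakter_gen hζ e hD
  have hζ2 : ζ ^ 2 = -1 := (hζ.pow (by norm_num) (show 4 = 2 * 2 by norm_num)).eq_neg_one_of_two_right
  -- the place over `2`
  obtain ⟨w₂, hw₂, h2w₂, hw₂8, hw₂3⟩ := exists_place_two (K := K) hζ
  have h2w : (2 : 𝓞 K) ∉ w.asIdeal := by
    have h := intCast_notMem (K := K) hp (n := 2)
      (fun h => hp2 ((Nat.prime_dvd_prime_iff_eq hp Nat.prime_two).mp (by exact_mod_cast h))) hpw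
    exact_mod_cast h
  have hww₂ : w ≠ w₂ := fun h => h2w (h ▸ h2w₂)
  have h𝔣w₂ : 𝔣 ≤ w₂.asIdeal := by
    rw [h𝔣def, Ideal.span_singleton_le_iff_mem, show ((8 * D : ℤ) : 𝓞 K) = 2 * ((4 * D : ℤ) : 𝓞 K) by push_cast; ring]
    exact w₂.asIdeal.mul_mem_right _ h2w₂
  -- `p ∣ D`: decompose `|D| = 2^j d`, `d = p^m c`, `p ∤ c`, `1 ≤ m ≤ 3`
  have hpD : (p : ℤ) ∣ D := by
    by_contra hnd
    have h8 : ¬ (p : ℤ) ∣ 8 * D := fun h => by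
      rcases (Nat.prime_iff_prime_int.mp hp).dvd_or_dvd h with h8 | h8
      · exact hp2 ((Nat.prime_dvd_prime_iff_eq hp Nat.prime_two).mp (hp.dvd_of_dvd_pow (by exact_mod_cast h8 : p ∣ 2 ^ 3)))
      · exact hnd h8
    exact intCast_notMem hp h8 hpw ((Ideal.span_singleton_le_iff_mem _).mp h𝔣w)
  obtain ⟨j, d, hdodd, hDd⟩ := Nat.exists_eq_two_pow_mul_odd (Int.natAbs_ne_zero.mpr hD)
  have hd0 : d ≠ 0 := by rintro rfl; simp at hdodd
  obtain ⟨m, c, hpc, hdmc⟩ := Nat.exists_eq_pow_mul_and_not_dvd hd0 p hp.one_lt.ne'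
  have hpd : p ∣ d := by
    have h1 : p ∣ D.natAbs := Int.natCast_dvd.mp hpD
    rw [hDd] at h1
    rcases (Nat.Prime.dvd_mul hp).mp h1 with h | h
    · exact absurd ((Nat.prime_dvd_prime_iff_eq hp Nat.prime_two).mp (hp.dvd_of_dvd_pow h)) hp2
    · exact h
  have hm1 : 1 ≤ m := by
    by_contra h0
    have : m = 0 := by omega
    rw [this, pow_zero, one_mul] at hdmc
    exact hpc (hdmc ▸ hpd)
  have hm3 : m ≤ 3 := by
    by_contra h4
    apply hD4 p hp
    have : (p : ℤ) ^ 4 ∣ (d : ℤ) := by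
      rw [hdmc]; push_cast
      exact Dvd.dvd.mul_right (pow_dvd_pow _ (by omega)) _
    have h2 : (d : ℤ) ∣ D := Int.natCast_dvd.mpr ⟨2 ^ j, by rw [hDd]; ring⟩
    exact this.trans h2
  -- `D = u · 2^j · D″` with `D″ = ±d ≡ 1 (4)`
  obtain ⟨ε, hε⟩ : ∃ ε : ℤˣ, ((ε : ℤ) * d) % 4 = 1 := by
    obtain ⟨k, hk⟩ := hdodd
    rcases Nat.even_or_odd k with ⟨l, hl⟩ | ⟨l, hl⟩
    · exact ⟨1, by rw [hk, hl]; push_cast; omega⟩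
    · exact ⟨-1, by rw [hk, hl]; push_cast; omega⟩
  set D'' : ℤ := (ε : ℤ) * d with hD''
  have hεsq : ((ε : ℤ) : ℤ) * (ε : ℤ) = 1 := by rcases Int.units_eq_one_or ε with rfl | rfl <;> simp
  have hDdec : D = (D.sign * (ε : ℤ)) * 2 ^ j * D'' := by
    have h := Int.sign_mul_natAbs D
    rw [hDd] at h
    push_cast at h
    rw [hD'']
    linear_combination -h - (D.sign * 2 ^ j * (d : ℤ)) * hεsq
  have hD''dec : D'' = ((ε : ℤ)) * (p : ℤ) ^ m * c := by rw [hD'', hdmc]; push_cast; ring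
  have hD''odd : ¬ ((2 : ℕ) : ℤ) ∣ D'' := by
    rw [hD'', Units.dvd_mul_left]
    exact_mod_cast hdodd.not_two_dvd_nat
  -- the complementary modulus and a non-square `g` mod `w`
  obtain ⟨J, hJcop, hJle⟩ := exists_complement h𝔣 w
  haveI : Finite (𝓞 K ⧸ w.asIdeal) := Ideal.finiteQuotientOfFreeOfNeBot w.asIdeal w.ne_bot
  letI : Fintype (𝓞 K ⧸ w.asIdeal) := Fintype.ofFinite _
  letI : Field (𝓞 K ⧸ w.asIdeal) := Ideal.Quotient.field _
  haveI := charP_quotient_of_natCast_mem (K := K) hpw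
  obtain ⟨x, hx⟩ := FiniteField.exists_nonsquare (F := 𝓞 K ⧸ w.asIdeal) (by rw [ringChar.eq (𝓞 K ⧸ w.asIdeal) p]; exact hp2)
  have hx0 : x ≠ 0 := by rintro rfl; exact hx (IsSquare.zero)
  obtain ⟨g, rfl⟩ := Ideal.Quotient.mk_surjective x
  have hgw : g ∉ w.asIdeal := fun h => hx0 (Ideal.Quotient.eq_zero_iff_mem.mpr h)
  -- the witness `a`: `a ≡ g (w)`, `a ≡ 1 (J)`
  obtain ⟨u', hu', v', hv', huv⟩ := Ideal.isCoprime_iff_exists.mp hJcop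
  set a : 𝓞 K := g * v' + u' with ha
  have hag : a - g ∈ w.asIdeal := by
    have : a - g = (1 - g) * u' := by rw [ha]; linear_combination g * huv
    rw [this]; exact w.asIdeal.mul_mem_left _ hu'
  have ha1J : a - 1 ∈ J := by
    have : a - 1 = (g - 1) * v' := by rw [ha]; linear_combination huv
    rw [this]; exact J.mul_mem_left _ hv'
  have haw : a ∉ w.asIdeal := fun h => hgw (by simpa using w.asIdeal.sub_mem h hag)
  have ha0 : a ≠ 0 := by rintro h; exact haw (h ▸ w.asIdeal.zero_mem)
  -- congruences of `a`
  have ha1v : ∀ v : HeightOneSpectrum (𝓞 K), v ≠ w → 𝔣 ≤ v.asIdeal → a - 1 ∈ v.asIdeal := fun v hvw hv =>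
    Ideal.pow_le_self (by omega) (hJle v hvw hv ha1J)
  have ha16 : a - 1 ∈ Ideal.span {(16 : 𝓞 K)} := by rw [← hw₂8]; exact Ideal.pow_le_pow_right (by omega) (hJle w₂ hww₂.symm h𝔣w₂ ha1J)
  have ha8 : a - 1 ∈ Ideal.span {(8 : 𝓞 K)} := Ideal.span_singleton_le_span_singleton.mpr ⟨2, by norm_num⟩ ha16
  have ha1 : a - 1 ∈ Ideal.span {(2 + 2 * ζ : 𝓞 K)} := by
    refine Ideal.span_singleton_le_span_singleton.mpr ⟨(2 - 2 * ζ) * 2, ?_⟩ ha16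
    linear_combination (8 : 𝓞 K) * hζ2
  have hav : ∀ v : HeightOneSpectrum (𝓞 K), 𝔣 ≤ v.asIdeal → a ∉ v.asIdeal := by
    intro v hv hmem
    by_cases hvw : v = w
    · exact haw (hvw ▸ hmem)
    · exact v.isPrime.ne_top (by
        rw [Ideal.eq_top_iff_one]; simpa using v.asIdeal.sub_mem hmem (ha1v v hvw hv))
  have hcopI : ∀ I : Ideal (𝓞 K), I ≠ ⊥ → 𝔣 ≤ I → IsCoprime (Ideal.span {a}) I := by
    intro I hI hle
    rw [Ideal.isCoprime_iff_sup_eq]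
    by_contra hne
    obtain ⟨M, hM, hleM⟩ := Ideal.exists_le_maximal _ hne
    have hMbot : M ≠ ⊥ := fun h0 => hI (le_bot_iff.mp (h0 ▸ (le_sup_right.trans hleM)))
    let v : HeightOneSpectrum (𝓞 K) := ⟨M, hM.isPrime, hMbot⟩
    exact hav v (hle.trans (le_sup_right.trans hleM)) (hleM (Ideal.mem_sup_left (Ideal.mem_span_singleton_self a)))
  have hcop𝔣 : IsCoprime (Ideal.span {a}) 𝔣 := hcopI 𝔣 h𝔣 le_rfl
  have hcopD'' : IsCoprime a (D'' : 𝓞 K) := by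
    rw [← Ideal.isCoprime_span_singleton_iff]
    refine hcopI _ (by rw [Ne, Ideal.span_singleton_eq_bot, hD'']; exact_mod_cast mul_ne_zero ε.ne_zero (by exact_mod_cast hd0)) ?_
    rw [h𝔣def, Ideal.span_singleton_le_span_singleton, hDdec]
    exact ⟨((8 * (D.sign * (ε : ℤ)) * 2 ^ j : ℤ) : 𝓞 K), by push_cast; ring⟩
  have hcopD : IsCoprime a (D : 𝓞 K) := by
    rw [← Ideal.isCoprime_span_singleton_iff]
    refine hcopI _ (by rw [Ne, Ideal.span_singleton_eq_bot]; exact_mod_cast hD) ?_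
    rw [h𝔣def, Ideal.span_singleton_le_span_singleton]
    exact ⟨8, by push_cast; ring⟩
  have h2a : ∀ v : HeightOneSpectrum (𝓞 K), Ideal.span {a} ≤ v.asIdeal → (2 : 𝓞 K) ∉ v.asIdeal := by
    intro v hv h2
    have hvw₂ : v = w₂ := eq_of_two_mem hζ hw₂ h2
    exact hav v (hvw₂ ▸ h𝔣w₂) ((Ideal.span_singleton_le_iff_mem _).mp hv)
  -- `(D/(a))₄ = (g/w)₄^m`
  set ρ := quarticResidueSymbol w (Ideal.Quotient.mk w.asIdeal g) with hρ
  have hρ2 : ρ ^ 2 = -1 := by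
    have h := quarticResidueSymbol_sq_eq_quadraticChar hζ h2w (Ideal.Quotient.mk w.asIdeal g)
    rw [quadraticChar_neg_one_iff_not_isSquare.mpr hx] at h
    simpa using h
  have hχ : quarticSymbol (Ideal.span {a}) (D : 𝓞 K) = ρ ^ m := by
    -- `D = (sign D · ε) · 2^j · D″`
    have hsu : quarticSymbol (Ideal.span {a}) (((D.sign * (ε : ℤ) : ℤ)) : 𝓞 K) = 1 := by
      have hs : D.sign = 1 ∨ D.sign = -1 := by
        rcases lt_trichotomy D 0 with h | h | h
        · exact Or.inr (Int.sign_eq_neg_one_of_neg h)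
        · exact absurd h hD
        · exact Or.inl (Int.sign_eq_one_of_pos h)
      rcases hs with hs | hs <;> rcases Int.units_eq_one_or ε with hε1 | hε1 <;>
        simp only [hs, hε1, Units.val_one, Units.val_neg, mul_one, mul_neg, neg_neg, Int.cast_one, Int.cast_neg,
          quarticSymbol_one_right hζ h2a, quarticSymbol_span_neg_one_eq_one_of_sub_one_mem_span_eight hζ ha8]
    have h2j : quarticSymbol (Ideal.span {a}) ((2 : 𝓞 K) ^ j) = 1 := by
      rw [quarticSymbol_pow_right hζ h2a, quarticSymbol_span_two_eq_one_of_sub_one_mem_span_sixteen hζ ha16, one_pow]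
    have hD''sym : quarticSymbol (Ideal.span {a}) (D'' : 𝓞 K) = ρ ^ m := by
      rw [← quarticSymbol_span_intCast_primary_comm hζ hε ha1 hcopD'', hD''dec, quarticSymbol_def,
        Multiset.prod_map_eq_pow_single w.asIdeal, quarticResidueSymbolIdeal_asIdeal,
        quarticResidueSymbol_mk_eq_mk_of_sub_mem w hag, count_normalizedFactors_span_eq hp hp2 hpw hpc m ε]
      intro P hPw hP
      have hP0 : Ideal.span {((((ε : ℤ)) * (p : ℤ) ^ m * c : ℤ) : 𝓞 K)} ≠ ⊥ := by
        rw [Ne, Ideal.span_singleton_eq_bot, ← hD''dec, hD'']; exact_mod_cast mul_ne_zero ε.ne_zero (by exact_mod_cast hd0)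
      obtain ⟨hPprime, hPle⟩ := (Ideal.mem_normalizedFactors_iff hP0).mp hP
      have hPbot : P ≠ ⊥ := (prime_of_normalized_factor P hP).ne_zero
      let v : HeightOneSpectrum (𝓞 K) := ⟨P, hPprime, hPbot⟩
      have hvw : v ≠ w := fun h => hPw (congrArg HeightOneSpectrum.asIdeal h)
      have h𝔣v : 𝔣 ≤ v.asIdeal := by
        refine le_trans ?_ hPle
        rw [h𝔣def, Ideal.span_singleton_le_span_singleton, ← hD''dec, hDdec]
        exact ⟨((8 * (D.sign * (ε : ℤ)) * 2 ^ j : ℤ) : 𝓞 K), by push_cast; ring⟩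
      have h2v : (2 : 𝓞 K) ∉ v.asIdeal := by
        intro h2
        have hD''v : ((D'' : ℤ) : 𝓞 K) ∈ v.asIdeal := by
          rw [hD''dec]; exact (Ideal.span_singleton_le_iff_mem _).mp hPle
        exact intCast_notMem Nat.prime_two hD''odd (by exact_mod_cast h2) hD''v
      rw [quarticResidueSymbolIdeal_of_isPrime hPprime hPbot]
      have : Ideal.Quotient.mk P a = Ideal.Quotient.mk P 1 := by
        rw [Ideal.Quotient.eq]; exact ha1v v hvw h𝔣v
      rw [this, map_one]
      exact quarticResidueSymbol_one hζ h2v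
    rw [hDdec]; push_cast
    rw [quarticSymbol_mul_right hζ, quarticSymbol_mul_right hζ, hD''sym, h2j]
    push_cast at hsu
    rw [hsu, one_mul, one_mul]
  -- conclusion: `(D/(a))₄³ ≠ 1`
  have hχ4 : quarticSymbol (Ideal.span {a}) (D : 𝓞 K) ^ 4 = 1 := quarticSymbol_span_pow_four_eq_one hζ ha1 hcopD
  have hχne : quarticSymbol (Ideal.span {a}) (D : 𝓞 K) ≠ 1 := by
    rw [hχ]
    have h2ne : (2 : 𝓞 K) ≠ 0 := two_ne_zero
    have hρ1 : ρ ≠ 1 := fun h => h2ne (by linear_combination hρ2 - (ρ + 1) * h)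
    interval_cases m
    · rwa [pow_one]
    · rw [hρ2]; intro h; exact h2ne (by linear_combination -h)
    · intro h
      apply hρ1
      have h4 : ρ ^ 4 = 1 := by rw [show (4 : ℕ) = 2 * 2 by norm_num, pow_mul, hρ2]; norm_num
      linear_combination h4 - ρ * h
  refine not_isUnramifiedAt_heckeOfGross_of_ne h𝔣 hψ h𝔣w haw hcop𝔣
    (fun v hvw hv => hJle v hvw ((modulusExp_ne_zero_iff _ h𝔣 v).mp hv) ha1J |> Ideal.pow_le_pow_right (by omega)) ?_
  rw [prod_embedding_eq, idealPow_gen_span hζ e ha0 ha1]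
  intro h
  have hea : e (a : K) ≠ 0 := by
    rw [map_ne_zero]; exact_mod_cast ha0
  have h1 : e ((quarticSymbol (Ideal.span {a}) (D : 𝓞 K) ^ 3 : 𝓞 K) : K) = 1 := by
    have := mul_right_cancel₀ hea (h.trans (one_mul _).symm)
    exact this
  have h1' : quarticSymbol (Ideal.span {a}) (D : 𝓞 K) ^ 3 = 1 := by
    have := e.injective (h1.trans (map_one e).symm)
    exact_mod_cast this
  apply hχne
  linear_combination hχ4 - quarticSymbol (Ideal.span {a}) (D : 𝓞 K) * h1'

/-! ### §5 Every prime of the modulus -/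

include hζ in
/-- ★★ **The Hecke character of `y² = x³ − Dx` is ramified at every prime `w ∣ (8D)`** (`D ≠ 0` free of fourth powers): the conductor
of `ψ_{E_D}` is supported exactly on the primes of `2D` (Deuring: `N_{E_D} = N(𝔣_ψ)·4`). [cite: IrelandRosen1990, Ch. 18 §6 Theorem 7 and §7]
[cite: SilvermanATAEC1994, Ch. II Thm. 10.5] -/
theorem not_isUnramifiedAt_gen (e : K →+* ℂ) {D : ℤ} (hD : D ≠ 0) (hD4 : ∀ q : ℕ, q.Prime → ¬ (q : ℤ) ^ 4 ∣ D)
    {w : HeightOneSpectrum (𝓞 K)} (h𝔣w : Ideal.span {((8 * D : ℤ) : 𝓞 K)} ≤ w.asIdeal) :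
    ¬ (heckeOfGross (span_ne_bot hD) (isGrossencharakter_gen hζ e hD)).IsUnramifiedAt w := by
  obtain ⟨ℓ, hℓ, hℓw, -⟩ := exists_prime_mem h𝔣w
  by_cases hℓ2 : ℓ = 2
  · subst hℓ2
    exact not_isUnramifiedAt_gen_two hζ e hD (by exact_mod_cast hℓw)
  · exact not_isUnramifiedAt_gen_odd hζ e hD hD4 hℓ hℓ2 hℓw h𝔣w

end Literature.NumberTheory.GaloisRepresentations.QuarticTwistDatum
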